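import Summits.ResolutionOfSingularities.ResolutionOfSingularities.Theorems.RadicialJungCleanModelsLens5TFramePMon
import Summits.ResolutionOfSingularities.ResolutionOfSingularities.Theorems.RadicialJungCleanModelsLens5TFrameCompositionOfThm11
import HarnessLib

/-!
# RadicialJungCleanModelsLens5TFramePMon — re-threaded through Cossart–Piltant 2019 Thm. 1.1 (i)–(iii) (`_thm11` variants)

Route `RadicialJung`, crux `CleanModels` (stmt-ResolutionOfSingularities-15917), line `Sketch`.  The declarations below are the
tree's theorems of the same names WITHOUT the suffix `_thm11` (file `RadicialJungCleanModelsLens5TFramePMon.lean`), with the embedded-resolution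
HYPOTHESIS `hEmb` (CJS 2020 Cor. 1.5 shape; skeleton stub `stub_cjs2020Thm14` = F-32) REPLACED by the typed verbatim
Cossart–Piltant 2019 Thm. 1.1 (i)–(iii) `CP2019.CossartPiltant2019Thm11`, through the doubling trick
(`Doubling.hEmb_zeroLocus_of_thm11`, `exists_localRing_monomial_of_thm11_dim`).  Proof bodies are the tree's, verbatim — credit to
the original file and its authors (res-B-lens-5, res-B-lead-1 and workers); only the binder and the threaded call differ.  
OURS; nothing here proves resolution in characteristic `p`.
-/

set_option linter.dupNamespace false -- mandated namespace of this single-conjunct summit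

section

open IsLocalRing
open Literature.AlgebraicGeometry.Resolution
open Summit.ResolutionOfSingularities.ResolutionOfSingularities.Theorems.RadicialJung.CleanModels
open Summit.ResolutionOfSingularities.ResolutionOfSingularities.Theorems.RadicialJung.CleanModels.Lens5
open Summit.ResolutionOfSingularities.ResolutionOfSingularities.Theorems.RadicialJung.CleanModels.Lens5.PRankTwoCurrency
open Summit.ResolutionOfSingularities.ResolutionOfSingularities.Theorems.RadicialJung.CleanModels.Lens5.PRankTwoAssembly
open Summit.ResolutionOfSingularities.ResolutionOfSingularities.Theorems.RadicialJungCleanModels.Lens5RegularityCriterion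
open Summit.ResolutionOfSingularities.ResolutionOfSingularities.Theorems.RadicialJungCleanModels.Lens5ChartSurjection

namespace Summit.ResolutionOfSingularities.ResolutionOfSingularities.Theorems.RadicialJungCleanModels.Lens5TFrame

/-! ## §I (rev 3) `p`-MONOMIAL FRAMES — (MULT), (1), (DEG) discharged: the slice over «`r` elements of `O_v` with `p`-independent residues and
`[K : K^p] = p^{r+3}`»

A frame need not be given axiomatically.  For `w : Fin r → O_v` let `W_e := ∏ i, w_i^{e_i}` (`e : Fin r → Fin p`) be its `p^r` `p`-MONOMIALS.
(MULT) and (1) hold identically (`w_i^p ∈ K^p`, exponents add mod `p`), so a monomial frame is subject to two conditions only: (RPI) for the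
monomial family — literally «the residues `w̄_i` are `p`-independent in `κ_v` over `κ_v^p`» — and (DEG), which by the tower `K^p ⊆ K^p(W) ⊆ K` and
`[K^p(W) : K^p] = p^r` (§D, from RG over `K^p`, where IR is trivial) is the numerical invariant `[K : K^p] = p^{r+3}` of `K` ALONE
(`cleanLU3DefectPRankTwoPMon_of_frame`).  Since `[K : K^p] = p^3·[k : k^p]` for `K/k` finitely generated of transcendence degree `3` (the degree of
imperfection is additive: invariant under finite extensions — count `[L : K^p]` two ways — and `+1` per transcendental element — `k(y) = ⊕ k^p(y) e_i`
for a `k^p`-basis `e_i` of `k`; Becker–MacLane 1940, Bourbaki A.V §13 ex.; BY HAND, memo CLASSBC §25), the kernel slice `CleanLU3DefectPRankTwoPMonAt p`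
reads, for `k` of finite `p`-rank `r₀ = log_p [k : k^p]`: (P2) and «`O_v` contains `r₀` elements whose residues are `p`-independent over `κ_v^p`»,
i.e. `[κ_v : κ_v^p] ≥ [k : k^p]` — which for `κ_v/k` algebraic (automatic under (P2) + `htd`, ✓ currency §K) is `[κ_v : κ_v^p] = [k : k^p] < ∞`.
Case `r = 0` (`W = {1}`, `[K : K^p] = p³`) is THEOREM T's perfect-ground slice with the perfectness of `k` replaced by the one number `[K : K^p]`. -/

section PMonomialFrames

open AlgebraicGeometry CategoryTheory in
/-- **THEOREM T⁗′** (kernel, inputs F-02 = the named fact `CossartPiltant2019` and F-32): the (P2)-slice of the lead's stub for a ground field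
of finite `p`-rank and `r` elements of `O_v` with `p`-independent residues, `[K : K^p] = p^{r+3}` — no frame axioms, no separability. [folklore] -/
theorem cleanLU3DefectPRankTwoPMon_of_cossartPiltant2019_thm11 (p : ℕ) [Fact p.Prime]
    (hCP : CossartPiltant2019.{0})
    (h11 : Literature.AlgebraicGeometry.CossartPiltant200819.CP2019.CossartPiltant2019Thm11.{0})
    : CleanLU3DefectPRankTwoPMonAt p :=
  cleanLU3DefectPRankTwoPMon_of_frame p (cleanLU3DefectPRankTwoFrame_of_cossartPiltant2019_thm11 p hCP h11)

end PMonomialFrames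

end Summit.ResolutionOfSingularities.ResolutionOfSingularities.Theorems.RadicialJungCleanModels.Lens5TFrame

end
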